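import Summits.KontsevichZagierPeriods.Zeta5Search.DenomLaw.OrbitCreditHLayers

/-!
# ζ(5) search — DENOM-LAW track D3: the H* increment — LAYER 2, multi-pole case (T), part A (structure lemmas)

Fifth file of the OrbitCredit lineage (`DenomLaw/OrbitCredit.lean`, `…Casoratian`, `…HLayers`, `…HSingle`): the seat file
`HOME/denom-law/code/d3g4/lean/OrbitCredit.lean` v6 (sha256 21381c2d…, author denom-theory-d3 g4, a planner seat) proved the multi-pole floor case
`FloorLayerMultiH` as ONE 434-line declaration; this file and `DenomLaw/OrbitCreditHMulti.lean` are its refactoring into named lemmas by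
denom-theory-d3 g5 (filed by the prover seat denom-engine-d2 with the tree's names `LoopAndPair` / `OrbitFloorHStar`).  Paper proof: SYMMETRY-D3 §9.9.4 (T).

CONTENT (all about the pole classes `{s ≤ b₀ : s ≡ x (mod p)}` of the cell's dual series in the first period `m₁ < 2p`):
small helpers (`pairTerm_minmax`, `pairTerm_le_pairSum`, `classSet_step`, `self_mem_classSet_min`, `classTop_spec`, `blockCount_eq_two_add`);
the CROSS DEFICIT `crossDef` of a block w.r.t. the two largest blocks and the two poles, `≥ 0` termwise (`two_le_cross`, `crossDef_nonneg`,
`crossDef_eq_zero`: a block of deficit `0` contains both poles or neither); the TWO-LARGEST-BLOCKS STRUCTURE `multiH_structure` (poles `q < q'`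
lie in `B_{j₁} ∩ B_{j₂}`, `q + p ≤ q'`, `⌊(b₀ − b_{j₁} − b_{j₂})/p⌋ = 1`, every other class point block-free of net exponent `1`); and the FLOOR
IDENTITY `multiH_key`: at the floor `E_x = −N_p`, `Σ_k crossDef k + [2q = b₀] + [2q' = b₀] + #Z + bonus + ρ = 1`.
HONEST FRAMING: systematic search; combinatorial statements about pole classes; nothing about ζ(5); no γ moves; no irrationality claim;
records in print UNMOVED.
-/

open Finset
open Summit.KontsevichZagierPeriods.Zeta5Search.WedgeDictionary (coeffV pfData dOf)
open Summit.KontsevichZagierPeriods.Zeta5Search.CasoratianValuation (InPolytope pairFloors shift casoratian)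

namespace Summit.KontsevichZagierPeriods.Zeta5Search.ClusterValuation.Orbit

open Summit.KontsevichZagierPeriods.Zeta5Search.ClusterValuation
open Summit.KontsevichZagierPeriods.Zeta5Search.PadicSeries (one_le_p zpow_p_nonneg)
open Summit.KontsevichZagierPeriods.Zeta5Search.DualSeries (InBox)
open Summit.KontsevichZagierPeriods.Zeta5Search.BigPrime (shift_zero dOf_shift)

/-! ### Helpers for the multi-pole floor case (T) -/

/-- `pairTerm` at `(min, max)` is `pairTerm`. -/
theorem pairTerm_minmax (b : ℕ → ℤ) (p i k : ℕ) : pairTerm b p (min i k) (max i k) = pairTerm b p i k := by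
  rcases le_total i k with h | h
  · rw [min_eq_left h, max_eq_right h]
  · rw [min_eq_right h, max_eq_left h, pairTerm_comm]

/-- A single pair term is below the restricted pair sum. -/
theorem pairTerm_le_pairSum (b : ℕ → ℤ) (hb : InPolytope b) (p : ℕ) {S : Finset ℕ} (hS : S ⊆ range 7) {i k : ℕ}
    (hi : i ∈ S) (hk : k ∈ S) (hik : i < k) : pairTerm b p i k ≤ pairSum b p S := by
  unfold pairSum
  have hnn : ∀ i' ∈ S, ∀ k' ∈ S, (0:ℤ) ≤ (if i' < k' then pairTerm b p i' k' else 0) := by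
    intro i' hi' k' hk'
    split_ifs
    · exact pairTerm_nonneg b hb p (mem_range.1 (hS hi')) (mem_range.1 (hS hk'))
    · exact le_rfl
  calc pairTerm b p i k = (if i < k then pairTerm b p i k else 0) := by rw [if_pos hik]
    _ ≤ ∑ k' ∈ S, (if i < k' then pairTerm b p i k' else 0) :=
        single_le_sum (f := fun k' => if i < k' then pairTerm b p i k' else 0) (hnn i hi) hk
    _ ≤ ∑ i' ∈ S, ∑ k' ∈ S, (if i' < k' then pairTerm b p i' k' else 0) :=
        single_le_sum (f := fun i' => ∑ k' ∈ S, (if i' < k' then pairTerm b p i' k' else 0))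
          (fun i' hi' => sum_nonneg (hnn i' hi')) hi

/-- Two distinct points of one class differ by at least `p`. -/
theorem classSet_step (b : ℕ → ℤ) {p x a c : ℕ} (ha : a ∈ classSet b p x) (hc : c ∈ classSet b p x) (hac : a < c) :
    a + p ≤ c := by
  have hra : a % p = x % p := (mem_filter.1 ha).2
  have hrc : c % p = x % p := (mem_filter.1 hc).2
  have hda := Nat.div_add_mod a p
  have hdc := Nat.div_add_mod c p
  rcases Nat.lt_or_ge (a / p) (c / p) with hlt' | hle
  · have := Nat.mul_le_mul_left p (show a / p + 1 ≤ c / p from hlt')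
    rw [mul_add, mul_one] at this
    omega
  · have := Nat.mul_le_mul_left p hle
    omega

/-- For `x < p ≤ b₀`, `x` lies in its class and is its least element. -/
theorem self_mem_classSet_min (b : ℕ → ℤ) {p x : ℕ} (hpb : (p : ℤ) ≤ b 0) (hx : x < p) :
    x ∈ classSet b p x ∧ ∀ s ∈ classSet b p x, x ≤ s := by
  have h0 : (0 : ℤ) ≤ b 0 := le_trans (by exact_mod_cast Nat.zero_le p) hpb
  have hb0 : (((b 0).toNat : ℕ) : ℤ) = b 0 := Int.toNat_of_nonneg h0
  refine ⟨?_, fun s hs => ?_⟩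
  · unfold classSet
    rw [mem_filter, mem_range]
    refine ⟨?_, rfl⟩
    have : (x : ℤ) < (p : ℤ) := by exact_mod_cast hx
    omega
  · have hrs : s % p = x % p := (mem_filter.1 hs).2
    have hxp : x % p = x := Nat.mod_eq_of_lt hx
    have := Nat.mod_le s p
    omega

/-- The top point `T = τ x = b₀ − ((b₀ − x) mod p)` of the class of `x < p ≤ b₀`: it lies in the class, it is its largest element,
and `T + p > b₀`. -/
theorem classTop_spec (b : ℕ → ℤ) {p x T : ℕ} (hp : 0 < p) (hpb : (p : ℤ) ≤ b 0) (hx : x < p)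
    (hT : (b 0).toNat - ((b 0).toNat - x) % p = T) :
    T ∈ classSet b p x ∧ (∀ s ∈ classSet b p x, s ≤ T) ∧ (b 0).toNat < T + p := by
  obtain ⟨hxmem, -⟩ := self_mem_classSet_min b hpb hx
  have hpx := palTau_class b hp hx hxmem
  simp only [Nat.sub_self, Nat.sub_zero, hT] at hpx
  obtain ⟨hTmem, -, -, -⟩ := hpx
  refine ⟨hTmem, fun s hs => ?_, ?_⟩
  · have hle := (palTau_eq b hp hx hs).1
    have hrs : s % p = x % p := (mem_filter.1 hs).2
    have hxp : x % p = x := Nat.mod_eq_of_lt hx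
    have hds := Nat.div_add_mod s p
    have hdn := Nat.div_add_mod ((b 0).toNat - x) p
    have := Nat.mul_le_mul_left p hle
    omega
  · have hxTn : x ≤ (b 0).toNat := le_of_mem_classSet b hxmem
    have := Nat.mod_lt ((b 0).toNat - x) hp
    omega

/-- Depth of a point lying in two given blocks `j₁ ≠ j₂`: `bc s = 2 + Σ_{k ≠ j₁, j₂} [s ∈ B_k]`. -/
theorem blockCount_eq_two_add (b : ℕ → ℤ) {s j₁ j₂ : ℕ} (hj₁ : j₁ ∈ range 7) (hj₂ : j₂ ∈ (range 7).erase j₁)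
    (h1 : s ∈ blk b j₁) (h2 : s ∈ blk b j₂) :
    (blockCount b s : ℤ) = 2 + ∑ k ∈ ((range 7).erase j₁).erase j₂, (if s ∈ blk b k then (1 : ℤ) else 0) := by
  have e1 : (if s ∈ blk b j₁ then (1 : ℤ) else 0) + ∑ k ∈ (range 7).erase j₁, (if s ∈ blk b k then (1 : ℤ) else 0) =
      ∑ k ∈ range 7, (if s ∈ blk b k then (1 : ℤ) else 0) :=
    add_sum_erase (range 7) (fun k => if s ∈ blk b k then (1 : ℤ) else 0) hj₁
  have e2 : (if s ∈ blk b j₂ then (1 : ℤ) else 0) + ∑ k ∈ ((range 7).erase j₁).erase j₂, (if s ∈ blk b k then (1 : ℤ) else 0) =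
      ∑ k ∈ (range 7).erase j₁, (if s ∈ blk b k then (1 : ℤ) else 0) :=
    add_sum_erase ((range 7).erase j₁) (fun k => if s ∈ blk b k then (1 : ℤ) else 0) hj₂
  rw [if_pos h1] at e1
  rw [if_pos h2] at e2
  have e3 : (blockCount b s : ℤ) = ∑ k ∈ range 7, (if s ∈ blk b k then (1 : ℤ) else 0) := by
    rw [blockCount_eq, card_filter]
    push_cast
    rfl
  linarith only [e1, e2, e3]

/-! ### Cross pairs: the cross deficit of a block w.r.t. the two largest blocks and the two poles -/

/-- The **cross deficit** of block `k`: its two cross pair terms with the distinguished blocks `j₁, j₂` minus the indicators of the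
poles `q, q'` lying in `B_k`. -/
def crossDef (b : ℕ → ℤ) (p j₁ j₂ q q' k : ℕ) : ℤ :=
  pairTerm b p j₁ k + pairTerm b p j₂ k - (if q ∈ blk b k then 1 else 0) - (if q' ∈ blk b k then 1 else 0)

/-- **Cross pairs are large in pairs**: if both poles `q, q'` (`q + p ≤ q'`) lie in `B_{j₁} ∩ B_{j₂}` and the block `B_k` passes through
one of them, then both cross pairs `(j₁,k)`, `(j₂,k)` are large (`one_le_pairTerm_cross` twice). -/
theorem two_le_cross (b : ℕ → ℤ) (hb : InPolytope b) {p j₁ j₂ q q' k : ℕ} (hp : 0 < p) (hj₁ : j₁ < 7) (hj₂ : j₂ < 7)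
    (hk : k < 7) (hq1 : q ∈ blk b j₁) (hq2 : q ∈ blk b j₂) (hq'1 : q' ∈ blk b j₁) (hq'2 : q' ∈ blk b j₂)
    (hqq' : q + p ≤ q') (hor : q ∈ blk b k ∨ q' ∈ blk b k) : 2 ≤ pairTerm b p j₁ k + pairTerm b p j₂ k := by
  rcases hor with hqk | hq'k
  · have h1 := one_le_pairTerm_cross b hb hp hk hj₁ hqk hq'1 hqq'
    have h2 := one_le_pairTerm_cross b hb hp hk hj₂ hqk hq'2 hqq'
    rw [pairTerm_minmax, pairTerm_comm] at h1 h2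
    linarith only [h1, h2]
  · have h1 := one_le_pairTerm_cross b hb hp hj₁ hk hq1 hq'k hqq'
    have h2 := one_le_pairTerm_cross b hb hp hj₂ hk hq2 hq'k hqq'
    rw [pairTerm_minmax] at h1 h2
    linarith only [h1, h2]

/-- Hence every cross deficit is `≥ 0` … -/
theorem crossDef_nonneg (b : ℕ → ℤ) (hb : InPolytope b) {p j₁ j₂ q q' k : ℕ} (hp : 0 < p) (hj₁ : j₁ < 7) (hj₂ : j₂ < 7)
    (hk : k < 7) (hq1 : q ∈ blk b j₁) (hq2 : q ∈ blk b j₂) (hq'1 : q' ∈ blk b j₁) (hq'2 : q' ∈ blk b j₂)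
    (hqq' : q + p ≤ q') : 0 ≤ crossDef b p j₁ j₂ q q' k := by
  unfold crossDef
  have h1 := pairTerm_nonneg b hb p hj₁ hk
  have h2 := pairTerm_nonneg b hb p hj₂ hk
  by_cases hqk : q ∈ blk b k
  · rw [if_pos hqk]
    have h3 := two_le_cross b hb hp hj₁ hj₂ hk hq1 hq2 hq'1 hq'2 hqq' (Or.inl hqk)
    by_cases hq'k : q' ∈ blk b k
    · rw [if_pos hq'k]; linarith only [h3]
    · rw [if_neg hq'k]; linarith only [h3]
  · rw [if_neg hqk]
    by_cases hq'k : q' ∈ blk b k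
    · rw [if_pos hq'k]
      have h3 := two_le_cross b hb hp hj₁ hj₂ hk hq1 hq2 hq'1 hq'2 hqq' (Or.inr hq'k)
      linarith only [h3]
    · rw [if_neg hq'k]; linarith only [h1, h2]

/-- … and a block of cross deficit `0` contains both poles or neither. -/
theorem crossDef_eq_zero (b : ℕ → ℤ) (hb : InPolytope b) {p j₁ j₂ q q' k : ℕ} (hp : 0 < p) (hj₁ : j₁ < 7) (hj₂ : j₂ < 7)
    (hk : k < 7) (hq1 : q ∈ blk b j₁) (hq2 : q ∈ blk b j₂) (hq'1 : q' ∈ blk b j₁) (hq'2 : q' ∈ blk b j₂)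
    (hqq' : q + p ≤ q') (h : crossDef b p j₁ j₂ q q' k = 0) : (q ∈ blk b k ↔ q' ∈ blk b k) := by
  unfold crossDef at h
  by_cases hqk : q ∈ blk b k <;> by_cases hq'k : q' ∈ blk b k
  · exact ⟨fun _ => hq'k, fun _ => hqk⟩
  · exfalso
    rw [if_pos hqk, if_neg hq'k] at h
    have h3 := two_le_cross b hb hp hj₁ hj₂ hk hq1 hq2 hq'1 hq'2 hqq' (Or.inl hqk)
    linarith only [h, h3]
  · exfalso
    rw [if_neg hqk, if_pos hq'k] at h
    have h3 := two_le_cross b hb hp hj₁ hj₂ hk hq1 hq2 hq'1 hq'2 hqq' (Or.inr hq'k)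
    linarith only [h, h3]
  · exact ⟨fun h' => absurd h' hqk, fun h' => absurd h' hq'k⟩

/-! ### The two-largest-blocks structure of a multi-pole class in the first period -/

/-- **Two-largest-blocks structure** (first period `m₁ < 2p`): if `q < q'` are poles of the class of `x < p` and `j₁, j₂` are the two
largest blocks (`b_{j₁} ≤ b_{j₂} ≤` all other `b_k`), then both poles lie in `B_{j₁} ∩ B_{j₂}` (`two_le_blockCount_of_pole`,
`mem_largest_of_blockCount`, `mem_second_of_blockCount`), `q + p ≤ q'`, the pair `(j₁, j₂)` has `⌊(b₀ − b_{j₁} − b_{j₂})/p⌋ = 1`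
((F1) `floorFact1` with `n_{j₁} ≥ n_{j₂} ≥ 2` against `pair ≤ m₁ < 2p`), so `class ∩ B_{j₁} = {q, q'}` and every other class point lies
in no block at all and has net exponent `1`. -/
theorem multiH_structure (b : ℕ → ℤ) (hb : InPolytope b) {p x q q' j₁ j₂ : ℕ} (hp : 0 < p) (hm1 : mOne b < 2 * (p : ℤ))
    (hqmem : q ∈ classSet b p x) (hqneg : netExp b q < 0) (hq'mem : q' ∈ classSet b p x) (hq'neg : netExp b q' < 0)
    (hlt : q < q') (hj₁ : j₁ ∈ range 7) (hj₂ : j₂ ∈ (range 7).erase j₁)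
    (hmin₁ : ∀ k ∈ range 7, b (j₁ + 1) ≤ b (k + 1)) (hmin₂ : ∀ k ∈ (range 7).erase j₁, b (j₂ + 1) ≤ b (k + 1)) :
    (q ∈ blk b j₁ ∧ q ∈ blk b j₂ ∧ q' ∈ blk b j₁ ∧ q' ∈ blk b j₂) ∧ q + p ≤ q' ∧ pairTerm b p j₁ j₂ = 1 ∧
      ∀ s ∈ classSet b p x, s ≠ q → s ≠ q' → (∀ k < 7, s ∉ blk b k) ∧ netExp b s = 1 := by
  have hp' : (0 : ℤ) < (p : ℤ) := by exact_mod_cast hp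
  have hbox : InBox b := hb.1
  have hj₁7 := mem_range.1 hj₁
  have hj₂7 := mem_range.1 (mem_erase.1 hj₂).2
  have hj₂1 : j₂ ≠ j₁ := (mem_erase.1 hj₂).1
  have h12 : b (j₁ + 1) ≤ b (j₂ + 1) := hmin₁ j₂ (mem_erase.1 hj₂).2
  -- the poles lie in `B_{j₁} ∩ B_{j₂}`
  have hq2bc := two_le_blockCount_of_pole b hqneg
  have hq'2bc := two_le_blockCount_of_pole b hq'neg
  have hq1 : q ∈ blk b j₁ := mem_largest_of_blockCount b hbox hj₁ hmin₁ (by omega)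
  have hq2 : q ∈ blk b j₂ := mem_second_of_blockCount b hbox hj₂ hmin₂ hq2bc
  have hq'1 : q' ∈ blk b j₁ := mem_largest_of_blockCount b hbox hj₁ hmin₁ (by omega)
  have hq'2 : q' ∈ blk b j₂ := mem_second_of_blockCount b hbox hj₂ hmin₂ hq'2bc
  have hqq' : q + p ≤ q' := classSet_step b hqmem hq'mem hlt
  -- (F1) in the two largest blocks: `n_{j₁} = n_{j₂} = 2`, `pairTerm j₁ j₂ = 1`
  have hn2 : 2 ≤ nB b p x j₂ := by
    unfold nB
    exact one_lt_card.2 ⟨q, mem_filter.2 ⟨hqmem, hq2⟩, q', mem_filter.2 ⟨hq'mem, hq'2⟩, by omega⟩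
  have hn12 : nB b p x j₂ ≤ nB b p x j₁ := nB_mono b hbox p x hj₁7 hj₂7 h12
  have hF1 := floorFact1 b hb hp hj₁7 hj₂7 (by omega : 1 ≤ nB b p x j₁) (by omega : 1 ≤ nB b p x j₂)
  have hpt1 : pairTerm b p j₁ j₂ ≤ 1 := by
    have hm := pair_le_mOne b hj₁7 hj₂7 hj₂1.symm
    unfold pairTerm
    have : (b 0 - b (j₁ + 1) - b (j₂ + 1)) / (p : ℤ) < 2 := by
      rw [Int.ediv_lt_iff_lt_mul hp']; linarith only [hm, hm1]
    omega
  have hn2z : (2 : ℤ) ≤ (nB b p x j₂ : ℤ) := by exact_mod_cast hn2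
  have hn12z : (nB b p x j₂ : ℤ) ≤ (nB b p x j₁ : ℤ) := by exact_mod_cast hn12
  have hn1z : (nB b p x j₁ : ℤ) = 2 := by linarith only [hF1, hpt1, hn2z, hn12z]
  have hn1eq : nB b p x j₁ = 2 := by exact_mod_cast hn1z
  have hpt : pairTerm b p j₁ j₂ = 1 := by linarith only [hF1, hpt1, hn2z, hn12z, hn1z]
  -- `class ∩ B_{j₁} = {q, q'}`; every other class point lies in no block
  have hB1 : (classSet b p x).filter (fun s => s ∈ blk b j₁) = {q, q'} := by
    symm
    refine eq_of_subset_of_card_le (fun s hs => ?_) (by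
      unfold nB at hn1eq
      rw [hn1eq, card_pair (by omega : q ≠ q')])
    rw [mem_insert, mem_singleton] at hs
    rw [mem_filter]
    rcases hs with hs | hs
    · rw [hs]; exact ⟨hqmem, hq1⟩
    · rw [hs]; exact ⟨hq'mem, hq'1⟩
  refine ⟨⟨hq1, hq2, hq'1, hq'2⟩, hqq', hpt, fun s hs hsq hsq' => ?_⟩
  have hnoblk : ∀ k < 7, s ∉ blk b k := by
    intro k hk hsk
    have hs1 : s ∈ blk b j₁ := blk_subset_blk b hbox hj₁7 hk (hmin₁ k (mem_range.2 hk)) hsk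
    have : s ∈ (classSet b p x).filter (fun s => s ∈ blk b j₁) := mem_filter.2 ⟨hs, hs1⟩
    rw [hB1, mem_insert, mem_singleton] at this
    rcases this with h | h
    · exact hsq h
    · exact hsq' h
  have hbc0 : blockCount b s = 0 := by
    rw [blockCount_eq]
    exact card_eq_zero.2 (filter_eq_empty_iff.2 fun k hk => hnoblk k (mem_range.1 hk))
  refine ⟨hnoblk, ?_⟩
  unfold netExp
  split_ifs with hc
  · have := blockCount_centre b hb hc; omega
  · rw [hbc0]; norm_num

/-- **The floor identity of case (T)**: with `N_p = pT(j₁,j₂) + Σ_{k ∉ {j₁,j₂}} (pT(j₁,k) + pT(j₂,k)) + ρ` (`pairSum_erase` twice; `ρ` = the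
pair sum over the other blocks), `bc q = 2 + Σ_k [q ∈ B_k]` (`blockCount_eq_two_add`) and `E = net q + net q' + #Z + bonus` (`Z` = the class
minus the two poles, each of its points of net exponent `1`), the floor equation `E_x = −N_p` together with `pT(j₁,j₂) = 1` reads
`Σ_k crossDef k + [2q = b₀] + [2q' = b₀] + #Z + bonus + ρ = 1`. -/
theorem multiH_key (b : ℕ → ℤ) {p x q q' j₁ j₂ : ℕ} (hj₁ : j₁ ∈ range 7) (hj₂ : j₂ ∈ (range 7).erase j₁)
    (hq1 : q ∈ blk b j₁) (hq2 : q ∈ blk b j₂) (hq'1 : q' ∈ blk b j₁) (hq'2 : q' ∈ blk b j₂) (hpt : pairTerm b p j₁ j₂ = 1)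
    (hqmem : q ∈ classSet b p x) (hq'mem : q' ∈ classSet b p x) (hlt : q < q')
    (hnet1 : ∀ s ∈ classSet b p x, s ≠ q → s ≠ q' → netExp b s = 1) (hE : classExp b p x = -pairFloors b p) :
    ∑ k ∈ ((range 7).erase j₁).erase j₂, crossDef b p j₁ j₂ q q' k + (if 2 * (q : ℤ) = b 0 then (1 : ℤ) else 0) +
      (if 2 * (q' : ℤ) = b 0 then (1 : ℤ) else 0) + ((((classSet b p x).erase q).erase q').card : ℤ) +
      (if ¬ (2 : ℤ) ∣ b 0 ∧ CentreIn b p x then (1 : ℤ) else 0) + pairSum b p (((range 7).erase j₁).erase j₂) = 1 := by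
  set R := ((range 7).erase j₁).erase j₂ with hR
  set Z := ((classSet b p x).erase q).erase q' with hZ
  have hNdec : pairFloors b p = (∑ k ∈ (range 7).erase j₁, pairTerm b p j₁ k) +
      ((∑ k ∈ R, pairTerm b p j₂ k) + pairSum b p R) := by
    rw [hR, ← pairSum_range, pairSum_erase b p hj₁, pairSum_erase b p hj₂]
  have hstar1 : ∑ k ∈ (range 7).erase j₁, pairTerm b p j₁ k = pairTerm b p j₁ j₂ + ∑ k ∈ R, pairTerm b p j₁ k := by
    rw [hR]; exact (add_sum_erase _ _ hj₂).symm
  have hq'e : q' ∈ (classSet b p x).erase q := mem_erase.2 ⟨by omega, hq'mem⟩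
  have hEdec : ∑ s ∈ classSet b p x, netExp b s = netExp b q + (netExp b q' + ∑ s ∈ Z, netExp b s) := by
    rw [hZ, add_sum_erase _ _ hq'e, add_sum_erase _ _ hqmem]
  have memZ : ∀ s, s ∈ Z ↔ s ∈ classSet b p x ∧ s ≠ q ∧ s ≠ q' := by
    intro s; rw [hZ, mem_erase, mem_erase]
    exact ⟨fun h => ⟨h.2.2, h.2.1, h.1⟩, fun h => ⟨h.2.2, h.2.1, h.1⟩⟩
  have hZsum : ∑ s ∈ Z, netExp b s = (Z.card : ℤ) := by
    rw [sum_congr rfl fun s hs => hnet1 s ((memZ s).1 hs).1 ((memZ s).1 hs).2.1 ((memZ s).1 hs).2.2]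
    simp
  have hbcq := blockCount_eq_two_add b hj₁ hj₂ hq1 hq2
  have hbcq' := blockCount_eq_two_add b hj₁ hj₂ hq'1 hq'2
  rw [← hR] at hbcq hbcq'
  have hDexp : ∑ k ∈ R, crossDef b p j₁ j₂ q q' k = ∑ k ∈ R, pairTerm b p j₁ k + ∑ k ∈ R, pairTerm b p j₂ k -
      ∑ k ∈ R, (if q ∈ blk b k then (1 : ℤ) else 0) - ∑ k ∈ R, (if q' ∈ blk b k then (1 : ℤ) else 0) := by
    unfold crossDef
    rw [sum_sub_distrib, sum_sub_distrib, sum_add_distrib]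
  have eq_q : netExp b q = 1 - (blockCount b q : ℤ) + (if 2 * (q : ℤ) = b 0 then (1 : ℤ) else 0) := rfl
  have eq_q' : netExp b q' = 1 - (blockCount b q' : ℤ) + (if 2 * (q' : ℤ) = b 0 then (1 : ℤ) else 0) := rfl
  have hE' : netExp b q + (netExp b q' + (Z.card : ℤ)) + (if ¬ (2 : ℤ) ∣ b 0 ∧ CentreIn b p x then (1 : ℤ) else 0) =
      -pairFloors b p := by
    unfold classExp at hE
    rw [hEdec, hZsum] at hE
    exact hE
  rw [hDexp]
  linarith only [hNdec, hstar1, hpt, hbcq, hbcq', eq_q, eq_q', hE']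

end Summit.KontsevichZagierPeriods.Zeta5Search.ClusterValuation.Orbit
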